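import Literature.Analysis.Calculus.BoxStokes
import Literature.Geometry.GeometricMeasureTheory.PullbackStokes
import Mathlib.Analysis.Calculus.InverseFunctionTheorem.ContDiff
import Mathlib.MeasureTheory.Function.Jacobian
import HarnessLib

/-!
# Stokes' theorem for a half-space and for superlevel sets through a straightening diffeomorphism

Chart-level Gauss–Green formulas feeding the computation of the slices of the current of a
holomorphic chain by spheres (`Literature/Geometry/Kaehler/HolomorphicChainSlice*.lean`): the
boundary of the current of integration over a superlevel set `{G > t}` of a smooth function at a
regular level is the current of integration over the level set `{G = t}`. Everything is proved from
Mathlib and the tree (the box theorem `Literature.Analysis.Calculus.integral_extDeriv_Icc_eq_sum_faces`);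
no definitions, no named facts.

* `integral_extDeriv_halfSpace_eq` — **Stokes for a coordinate half-space of `ℝ^{m+1}`**: for a
  compactly supported `C¹` real `m`-form `η` on `ℝ^{m+1} = Fin (m + 1) → ℝ`, a coordinate `i` and a
  level `t`,
  `∫_{x | t < x i} dη(e₀, …, e_m) dx = -(-1)ⁱ ∫_{y ∈ ℝ^m} η(insᵢ t y)(e ∘ succAbove i) dy`
  (the box theorem on a box with one face on the hyperplane `xᵢ = t` and all other faces off the
  support).
* `apply_comp_basis_eq_det_mul` — a top-degree form sees an endomorphism through its determinant.
* `integral_extDeriv_image_superlevel_eq` — **the same through a diffeomorphism**: if `Φ` is a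
  partial homeomorphism of `ℝ^{m+1}`, `C²` on its source, whose Jacobian determinant has the
  constant sign `σ` there, and `α` is a compactly supported `C¹` real `m`-form with support in the
  target, then
  `∫_{Φ(source ∩ {t < uᵢ})} dα(e) dx = -(-1)ⁱ σ ∫_{y | insᵢ t y ∈ source} α(Φ(insᵢ t y))(DΦ(insᵢ t y) e ∘ succAbove i) dy`
  (change of variables `MeasureTheory.integral_image_eq_integral_abs_det_fderiv_smul`,
  `dα(Φ u)(DΦ(u) e) = det DΦ(u) · dα(Φ u)(e)`, and `Φ^*(dα) = d(Φ^*α)` on the source, Mathlib's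
  `extDeriv_pullback`, for the extension by zero of `Φ^*α`).
* `exists_straighten` — **straightening a smooth function with `∂ᵢG ≠ 0`**: near a point `k₁` with
  `∂ᵢ G(k₁) ≠ 0` the map `Θ k = k + (G k - kᵢ) eᵢ` is a smooth diffeomorphism onto an open set
  (inverse function theorem); its inverse `Φ` satisfies `G (Φ u) = uᵢ`, `(Φ u)ⱼ = uⱼ` (`j ≠ i`),
  has injective differentials and a Jacobian determinant of constant sign.
* `exists_nhds_integral_extDeriv_superlevel_eq` — **local Gauss–Green at a regular level**: for
  `G` smooth near `k₁` with `dG(k₁) ≠ 0`, on the neighbourhood `Φ.target` of `k₁`,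
  `∫_{Φ.target ∩ {t < G}} dα(e) = θ ∫_{y | insᵢ t y ∈ Φ.source} α(Φ(insᵢ t y))(DΦ e ∘ succAbove i) dy`
  (`θ = ±1`) for all `C¹` forms `α` supported in `Φ.target` and all levels `t`: the boundary of the
  superlevel set is the level set, parametrised over `ℝ^m` by `y ↦ Φ(insᵢ t y)`.

## References

* M. Spivak, *Calculus on Manifolds*, Benjamin 1965, Thms. 4-13, 5-5 [Spivak1965].
* H. Federer, *Geometric Measure Theory*, Springer 1969, 3.1.18, 3.2.3, 4.1.7 [Federer1969].
-/

noncomputable section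

open scoped Topology ContDiff
open MeasureTheory Set Function Filter Metric

namespace Literature.Geometry.GeometricMeasureTheory

open Literature.Analysis.Calculus

/-! ### Stokes for a coordinate half-space -/

section HalfSpace

variable {m : ℕ}

/-- Off the closed ball of radius `R` containing the support, a form vanishes at every point with a
coordinate of absolute value `> R`. [folklore] -/
private theorem apply_eq_zero_of_abs_apply_gt
    {η : (Fin (m + 1) → ℝ) → (Fin (m + 1) → ℝ) [⋀^Fin m]→L[ℝ] ℝ} {R : ℝ}
    (hR : tsupport η ⊆ closedBall 0 R) {x : Fin (m + 1) → ℝ} {j : Fin (m + 1)} (hx : R < |x j|) :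
    η x = 0 := by
  refine image_eq_zero_of_notMem_tsupport fun hxs => ?_
  have h1 : ‖x‖ ≤ R := by simpa using hR hxs
  have h2 : |x j| ≤ ‖x‖ := by
    have := norm_le_pi_norm x j
    rwa [Real.norm_eq_abs] at this
  linarith

/-- The exterior derivative of a form vanishes off its topological support. [folklore] -/
private theorem extDeriv_apply_eq_zero_of_notMem_tsupport {E : Type*} [NormedAddCommGroup E] [NormedSpace ℝ E]
    {n : ℕ} {θ : E → E [⋀^Fin n]→L[ℝ] ℝ} {x : E} (hx : x ∉ tsupport θ) : extDeriv θ x = 0 := by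
  rw [(notMem_tsupport_iff_eventuallyEq.1 hx).extDeriv_eq]
  ext w
  simp [extDeriv, ContinuousAlternatingMap.alternatizeUncurryFin_apply]

/-- **Stokes' theorem for a coordinate half-space of `ℝ^{m+1}`.** For a compactly supported `C¹`
real `m`-form `η` on `ℝ^{m+1}`, a coordinate direction `i` and a level `t`,
`∫_{x | t < xᵢ} dη(e₀, …, e_m) dx = -(-1)ⁱ ∫_{ℝ^m} η(insᵢ t y)(e ∘ succAbove i) dy`: the box theorem
`integral_extDeriv_Icc_eq_sum_faces` on a box `[a, b]` with `aᵢ = t` and all other faces beyond the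
support, where only the back face `xᵢ = t` contributes. [cite: Spivak1965, Thm. 4-13] -/
theorem integral_extDeriv_halfSpace_eq
    (η : (Fin (m + 1) → ℝ) → (Fin (m + 1) → ℝ) [⋀^Fin m]→L[ℝ] ℝ) (hη : ContDiff ℝ 1 η)
    (hηs : HasCompactSupport η) (i : Fin (m + 1)) (t : ℝ) :
    ∫ x in {x | t < x i}, extDeriv η x (fun k => Pi.single k 1) =
      -((-1 : ℝ) ^ (i : ℕ) * ∫ y, η (i.insertNth t y) (fun j => Pi.single (i.succAbove j) 1)) := by
  -- a ball containing the support
  obtain ⟨R₀, hR₀⟩ := hηs.isCompact.isBounded.subset_closedBall 0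
  set R : ℝ := max R₀ 0 with hRdef
  have hR : tsupport η ⊆ closedBall 0 R := hR₀.trans (closedBall_subset_closedBall (le_max_left _ _))
  have hR0 : 0 ≤ R := le_max_right _ _
  -- the box
  set a : Fin (m + 1) → ℝ := i.insertNth t (fun _ => -(R + 1)) with ha
  set b : Fin (m + 1) → ℝ := fun _ => R + |t| + 1 with hb
  have hai : a i = t := by simp [ha]
  have haj : ∀ j, a (i.succAbove j) = -(R + 1) := fun j => by simp [ha]
  have hab : a ≤ b := by
    intro l
    rcases Fin.eq_self_or_eq_succAbove i l with rfl | ⟨j, rfl⟩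
    · rw [hai, hb]; linarith [le_abs_self t]
    · rw [haj, hb]; linarith [abs_nonneg t]
  -- the box theorem
  have hbox := integral_extDeriv_Icc_eq_sum_faces a b hab η isOpen_univ (subset_univ _) hη.contDiffOn
  -- the faces off the support vanish
  have hfront : ∀ j : Fin (m + 1), ∀ y : Fin m → ℝ, η (j.insertNth (b j) y) = 0 := fun j y =>
    apply_eq_zero_of_abs_apply_gt hR (j := j) (by
      rw [Fin.insertNth_apply_same, hb]
      rw [abs_of_nonneg (by positivity)]; linarith [abs_nonneg t])
  have hback : ∀ j : Fin (m + 1), j ≠ i → ∀ y : Fin m → ℝ, η (j.insertNth (a j) y) = 0 := by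
    intro j hj y
    obtain ⟨l, rfl⟩ := Fin.exists_succAbove_eq hj
    refine apply_eq_zero_of_abs_apply_gt hR (j := i.succAbove l) ?_
    rw [Fin.insertNth_apply_same, haj, abs_neg, abs_of_nonneg (by positivity)]
    linarith
  have hsum : (∑ j : Fin (m + 1), (-1 : ℝ) ^ (j : ℕ) •
      ((∫ y in Icc (a ∘ j.succAbove) (b ∘ j.succAbove),
          η (j.insertNth (b j) y) (fun l => Pi.single (j.succAbove l) 1)) -
        ∫ y in Icc (a ∘ j.succAbove) (b ∘ j.succAbove),
          η (j.insertNth (a j) y) (fun l => Pi.single (j.succAbove l) 1))) =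
      -((-1 : ℝ) ^ (i : ℕ) * ∫ y in Icc (a ∘ i.succAbove) (b ∘ i.succAbove),
          η (i.insertNth t y) (fun l => Pi.single (i.succAbove l) 1)) := by
    rw [Finset.sum_eq_single i]
    · simp only [hfront, ContinuousAlternatingMap.coe_zero, Pi.zero_apply, integral_zero, zero_sub,
        hai, smul_eq_mul, mul_neg]
    · intro j _ hj
      simp only [hfront, hback j hj, ContinuousAlternatingMap.coe_zero, Pi.zero_apply, integral_zero,
        sub_self, smul_zero]
    · intro h; exact absurd (Finset.mem_univ i) h
  -- the back face `xᵢ = t`: the box integral is the integral over all of `ℝ^m`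
  have hface : ∫ y in Icc (a ∘ i.succAbove) (b ∘ i.succAbove),
        η (i.insertNth t y) (fun l => Pi.single (i.succAbove l) 1) =
      ∫ y, η (i.insertNth t y) (fun l => Pi.single (i.succAbove l) 1) := by
    refine setIntegral_eq_integral_of_forall_compl_eq_zero fun y hy => ?_
    obtain ⟨l, hl⟩ : ∃ l, y l < a (i.succAbove l) ∨ b (i.succAbove l) < y l := by
      by_contra hcon
      push Not at hcon
      exact hy ⟨fun l => (hcon l).1, fun l => (hcon l).2⟩
    have hz : η (i.insertNth t y) = 0 := by
      refine apply_eq_zero_of_abs_apply_gt hR (j := i.succAbove l) ?_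
      rw [Fin.insertNth_apply_succAbove]
      rw [haj, hb] at hl
      rcases hl with hl | hl
      · have : y l < 0 := by linarith
        rw [abs_of_neg this]; linarith
      · have : 0 < y l := by linarith [abs_nonneg t]
        rw [abs_of_pos this]; linarith [abs_nonneg t]
    rw [hz, ContinuousAlternatingMap.coe_zero, Pi.zero_apply]
  -- the left-hand side: the box integral is the half-space integral
  have hzero : ∀ x, x ∉ Icc a b → t < x i → extDeriv η x (fun k => Pi.single k 1) = 0 := by
    intro x hx hxi
    obtain ⟨l, hl⟩ : ∃ l, x l < a l ∨ b l < x l := by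
      by_contra hcon
      push Not at hcon
      exact hx ⟨fun l => (hcon l).1, fun l => (hcon l).2⟩
    have hxs : x ∉ tsupport η := by
      intro hxs
      have h1 : ‖x‖ ≤ R := by simpa using hR hxs
      have h2 : |x l| ≤ R := by
        have := norm_le_pi_norm x l
        rw [Real.norm_eq_abs] at this
        exact this.trans h1
      have h3 : x l ≤ R := (le_abs_self _).trans h2
      have h4 : -R ≤ x l := by linarith [neg_abs_le (x l)]
      rcases Fin.eq_self_or_eq_succAbove i l with hl' | ⟨j, hj⟩
      · rw [hl', hai, hb] at hl
        rw [hl'] at h3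
        rcases hl with hl | hl
        · exact absurd hxi (not_lt.2 hl.le)
        · linarith [abs_nonneg t]
      · rw [hj, haj, hb] at hl
        rw [hj] at h3 h4
        rcases hl with hl | hl
        · linarith
        · linarith [abs_nonneg t]
    rw [extDeriv_apply_eq_zero_of_notMem_tsupport hxs, ContinuousAlternatingMap.coe_zero, Pi.zero_apply]
  have hlhs : ∫ x in {x | t < x i}, extDeriv η x (fun k => Pi.single k 1) =
      ∫ x in Icc a b, extDeriv η x (fun k => Pi.single k 1) := by
    -- both are the integral over `Icc a b ∩ {t < x i}`
    have h1 : ∫ x in {x | t < x i}, extDeriv η x (fun k => Pi.single k 1) =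
        ∫ x in Icc a b ∩ {x | t < x i}, extDeriv η x (fun k => Pi.single k 1) := by
      exact setIntegral_eq_of_subset_of_forall_sdiff_eq_zero
        (measurableSet_lt measurable_const (measurable_pi_apply i)) inter_subset_right
        fun x hx => hzero x (fun h => hx.2 ⟨h, hx.1⟩) hx.1
    have h2 : (Icc a b ∩ {x | t < x i} : Set (Fin (m + 1) → ℝ)) =ᵐ[volume] (Icc a b : Set _) := by
      have hnull : volume {x : Fin (m + 1) → ℝ | x i = t} = 0 := by
        rw [volume_pi]
        exact Measure.pi_hyperplane (fun _ : Fin (m + 1) => (volume : Measure ℝ)) i t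
      refine ae_eq_set.2 ⟨?_, ?_⟩
      · rw [show (Icc a b ∩ {x | t < x i}) \ Icc a b = (∅ : Set (Fin (m + 1) → ℝ)) from
          sdiff_eq_empty.2 inter_subset_left, measure_empty]
      · refine measure_mono_null (fun x hx => ?_) hnull
        have hxi : ¬ t < x i := fun h => hx.2 ⟨hx.1, h⟩
        have h1 : t ≤ x i := by have := hx.1.1 i; rwa [hai] at this
        show x i = t
        exact le_antisymm (not_lt.1 hxi) h1
    rw [h1, setIntegral_congr_set h2]
  rw [hlhs, hbox, hsum, hface]

end HalfSpace

/-! ### Through a diffeomorphism -/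

section Diffeo

variable {m : ℕ}

/-- **A top-degree form sees an endomorphism through its determinant**:
`α(A e₀, …, A e_m) = det A · α(e₀, …, e_m)` for the coordinate frame `e` of `ℝ^{m+1}`.
[cite: Federer1969, 1.4.4] -/
theorem apply_comp_basis_eq_det_mul (α : (Fin (m + 1) → ℝ) [⋀^Fin (m + 1)]→L[ℝ] ℝ)
    (A : (Fin (m + 1) → ℝ) →L[ℝ] (Fin (m + 1) → ℝ)) :
    α (fun k => A (Pi.single k 1)) = A.det * α (fun k => Pi.single k 1) := by
  set e := Pi.basisFun ℝ (Fin (m + 1)) with he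
  have hα := AlternatingMap.eq_smul_basis_det e α.toAlternatingMap
  have h1 : (fun k => A (Pi.single k 1)) = ⇑(A : (Fin (m + 1) → ℝ) →ₗ[ℝ] (Fin (m + 1) → ℝ)) ∘ ⇑e := by
    ext k : 1
    simp [he]
  have h2 : (fun k => (Pi.single k 1 : Fin (m + 1) → ℝ)) = ⇑e := by
    ext k : 1
    simp [he]
  have hA : α (fun k => A (Pi.single k 1)) =
      (α.toAlternatingMap e • e.det) (⇑(A : (Fin (m + 1) → ℝ) →ₗ[ℝ] (Fin (m + 1) → ℝ)) ∘ ⇑e) := by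
    rw [← hα, h1]; rfl
  rw [hA, AlternatingMap.smul_apply, Module.Basis.det_comp, Module.Basis.det_self, mul_one,
    smul_eq_mul, mul_comm, h2]
  rfl

/-- **Stokes for a superlevel half-space through a diffeomorphism.** Let `Φ` be a partial
homeomorphism of `ℝ^{m+1}` of class `C²` on its source, whose Jacobian determinant has a constant
sign `σ` there (`|det DΦ(u)| = σ det DΦ(u)`), and `α` a compactly supported `C¹` real `m`-form with
support inside the target. Then for every coordinate `i` and level `t`,
`∫_{Φ(source ∩ {t < uᵢ})} dα(e) dx = -(-1)ⁱ σ ∫_{y | insᵢ t y ∈ source} α(Φ(insᵢ t y))(DΦ(insᵢ t y) e ∘ succAbove i) dy`: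
change of variables (`MeasureTheory.integral_image_eq_integral_abs_det_fderiv_smul`), the
determinant rule for the top-degree form `dα`, `Φ^*(dα) = d(Φ^*α)` on the source
(`extDeriv_pullback`) for the extension by zero of `Φ^*α`, and `integral_extDeriv_halfSpace_eq`.
[cite: Spivak1965, Thm. 4-13, Thm. 5-5; Federer1969, 3.2.3, 4.1.7] -/
theorem integral_extDeriv_image_superlevel_eq
    (Φ : OpenPartialHomeomorph (Fin (m + 1) → ℝ) (Fin (m + 1) → ℝ)) (hΦ : ContDiffOn ℝ 2 Φ Φ.source)
    {σ : ℝ} (hσ : ∀ u ∈ Φ.source, |(fderiv ℝ Φ u).det| = σ * (fderiv ℝ Φ u).det)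
    {α : (Fin (m + 1) → ℝ) → (Fin (m + 1) → ℝ) [⋀^Fin m]→L[ℝ] ℝ} (hα : ContDiff ℝ 1 α)
    (hαs : HasCompactSupport α) (hαO : tsupport α ⊆ Φ.target) (i : Fin (m + 1)) (t : ℝ) :
    ∫ x in Φ '' (Φ.source ∩ {u | t < u i}), extDeriv α x (fun k => Pi.single k 1) =
      -((-1 : ℝ) ^ (i : ℕ) * σ * ∫ y in {y | i.insertNth t y ∈ Φ.source},
        α (Φ (i.insertNth t y)) (fun j => fderiv ℝ Φ (i.insertNth t y) (Pi.single (i.succAbove j) 1))) := by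
  classical
  have hsrc : IsOpen Φ.source := Φ.open_source
  -- the pulled-back form and its extension by zero
  set α₀ : (Fin (m + 1) → ℝ) → (Fin (m + 1) → ℝ) [⋀^Fin m]→L[ℝ] ℝ :=
    fun u => (α (Φ u)).compContinuousLinearMap (fderiv ℝ Φ u) with hα₀_def
  have hα₀ : ContDiffOn ℝ 1 α₀ Φ.source :=
    (hα.comp_contDiffOn (hΦ.of_le (by norm_num))).continuousAlternatingMapCompContinuousLinearMap
      (hΦ.fderiv_of_isOpen hsrc (by norm_num))
  set η : (Fin (m + 1) → ℝ) → (Fin (m + 1) → ℝ) [⋀^Fin m]→L[ℝ] ℝ :=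
    fun u => if u ∈ Φ.source then α₀ u else 0 with hη_def
  -- the compact set `C = Φ⁻¹(spt α) ∩ source` off which `η` vanishes
  set C : Set (Fin (m + 1) → ℝ) := Φ.symm '' tsupport α with hC
  have hCc : IsCompact C := hαs.isCompact.image_of_continuousOn (Φ.continuousOn_symm.mono hαO)
  have hCsrc : C ⊆ Φ.source := by
    rintro _ ⟨x, hx, rfl⟩
    exact Φ.map_target (hαO hx)
  have hzero : ∀ u ∈ Φ.source, u ∉ C → α (Φ u) = 0 := fun u hu huC => by
    refine image_eq_zero_of_notMem_tsupport fun h => huC ?_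
    exact ⟨Φ u, h, Φ.left_inv hu⟩
  have hagree : ∀ u ∈ Φ.source, η =ᶠ[𝓝 u] α₀ := fun u hu => by
    filter_upwards [hsrc.mem_nhds hu] with u' hu'
    simp [hη_def, hu']
  have hvanish : ∀ u ∉ C, η =ᶠ[𝓝 u] fun _ => 0 := fun u hu => by
    filter_upwards [hCc.isClosed.isOpen_compl.mem_nhds hu] with u' hu'
    by_cases hu's : u' ∈ Φ.source
    · simp only [hη_def, hu's, if_true, hα₀_def, hzero u' hu's hu']
      ext v
      simp
    · simp [hη_def, hu's]
  have hηC : ContDiff ℝ 1 η := contDiff_iff_contDiffAt.2 fun u => by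
    by_cases hu : u ∈ Φ.source
    · exact (hα₀.contDiffAt (hsrc.mem_nhds hu)).congr_of_eventuallyEq (hagree u hu)
    · exact contDiffAt_const.congr_of_eventuallyEq (hvanish u fun h => hu (hCsrc h))
  have hηs : HasCompactSupport η := by
    refine HasCompactSupport.intro hCc fun u hu => ?_
    exact (hvanish u hu).self_of_nhds
  -- on the source, `dη = Φ^*(dα)`
  have hd : ∀ u ∈ Φ.source,
      (extDeriv α (Φ u)).compContinuousLinearMap (fderiv ℝ Φ u) (fun k => Pi.single k 1) =
        extDeriv η u (fun k => Pi.single k 1) := fun u hu => by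
    have hΦu : ContDiffAt ℝ 2 Φ u := hΦ.contDiffAt (hsrc.mem_nhds hu)
    have hαu : DifferentiableAt ℝ α (Φ u) := (hα.differentiable one_ne_zero).differentiableAt
    rw [(hagree u hu).extDeriv_eq, hα₀_def, extDeriv_pullback hαu hΦu]
    rw [minSmoothness_of_isRCLikeNormedField]
  -- change of variables on `s = source ∩ {t < uᵢ}`
  set s : Set (Fin (m + 1) → ℝ) := Φ.source ∩ {u | t < u i} with hs
  have hsm : MeasurableSet s :=
    hsrc.measurableSet.inter (measurableSet_lt measurable_const (measurable_pi_apply i))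
  have hderiv : ∀ u ∈ s, HasFDerivWithinAt Φ (fderiv ℝ Φ u) s u := fun u hu =>
    (((hΦ.differentiableOn (by norm_num)) u hu.1).differentiableAt
      (hsrc.mem_nhds hu.1)).hasFDerivAt.hasFDerivWithinAt
  have hcv := integral_image_eq_integral_abs_det_fderiv_smul volume hsm hderiv
    (Φ.injOn.mono inter_subset_left) (fun x => extDeriv α x (fun k => Pi.single k 1))
  rw [hcv]
  -- the integrand on `s` is `σ dη(e)`
  have hint : ∀ u ∈ s, |(fderiv ℝ Φ u).det| • extDeriv α (Φ u) (fun k => Pi.single k 1) =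
      σ * extDeriv η u (fun k => Pi.single k 1) := fun u hu => by
    rw [smul_eq_mul, hσ u hu.1, ← hd u hu.1, ContinuousAlternatingMap.compContinuousLinearMap_apply,
      mul_assoc]
    congr 1
    exact (apply_comp_basis_eq_det_mul (extDeriv α (Φ u)) (fderiv ℝ Φ u)).symm
  rw [setIntegral_congr_fun hsm hint, integral_const_mul]
  -- `dη = 0` on `{t < uᵢ} ∖ s`
  have hout : ∀ u, u ∉ Φ.source → extDeriv η u (fun k => Pi.single k 1) = 0 := fun u hu => by
    rw [extDeriv_eq_zero_of_eventuallyEq_zero (hvanish u fun h => hu (hCsrc h))]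
    rfl
  have hs' : ∫ u in s, extDeriv η u (fun k => Pi.single k 1) =
      ∫ u in {u | t < u i}, extDeriv η u (fun k => Pi.single k 1) :=
    (setIntegral_eq_of_subset_of_forall_sdiff_eq_zero
      (measurableSet_lt measurable_const (measurable_pi_apply i)) inter_subset_right
      fun u hu => hout u fun h => hu.2 ⟨h, hu.1⟩).symm
  rw [hs', integral_extDeriv_halfSpace_eq η hηC hηs i t]
  -- the face integral only sees the source, where `η = Φ^*α`
  have hface : ∫ y, η (i.insertNth t y) (fun j => Pi.single (i.succAbove j) 1) =
      ∫ y in {y | i.insertNth t y ∈ Φ.source},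
        α (Φ (i.insertNth t y)) (fun j => fderiv ℝ Φ (i.insertNth t y) (Pi.single (i.succAbove j) 1)) := by
    rw [← setIntegral_eq_integral_of_forall_compl_eq_zero (s := {y | i.insertNth t y ∈ Φ.source})
      (fun y hy => by simp [hη_def, show i.insertNth t y ∉ Φ.source from hy])]
    refine setIntegral_congr_fun (hsrc.measurableSet.preimage (by fun_prop)) fun y hy => ?_
    simp only [hη_def, show i.insertNth t y ∈ Φ.source from hy, if_true, hα₀_def,
      ContinuousAlternatingMap.compContinuousLinearMap_apply]
    rfl
  rw [hface]
  ring

end Diffeo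

/-! ### Straightening a function with a non-vanishing partial derivative -/

section Straighten

variable {m : ℕ}

/-- The differential of `Θ k = k + (G k - kᵢ) eᵢ` is injective where `∂ᵢ G ≠ 0`. [folklore] -/
private theorem injective_id_add_smulRight {G' : (Fin (m + 1) → ℝ) →L[ℝ] ℝ} {i : Fin (m + 1)}
    (hi : G' (Pi.single i 1) ≠ 0) :
    Injective ⇑(ContinuousLinearMap.id ℝ (Fin (m + 1) → ℝ) +
      (G' - ContinuousLinearMap.proj i).smulRight (Pi.single i 1 : Fin (m + 1) → ℝ)) := by
  set L := ContinuousLinearMap.id ℝ (Fin (m + 1) → ℝ) +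
    (G' - ContinuousLinearMap.proj i).smulRight (Pi.single i 1 : Fin (m + 1) → ℝ) with hL
  refine (injective_iff_map_eq_zero L).2 fun w hw => ?_
  have hLw : ∀ j, L w j = w j + (G' w - w i) * (Pi.single i (1 : ℝ) : Fin (m + 1) → ℝ) j := fun j => by
    simp [hL]
  -- coordinates `j ≠ i` vanish
  have hwj : ∀ j, j ≠ i → w j = 0 := fun j hj => by
    have := congrFun hw j
    rw [hLw j, Pi.single_eq_of_ne hj, mul_zero, add_zero] at this
    exact this
  -- so `w = wᵢ eᵢ` and `G' w = 0`
  have hweq : w = w i • (Pi.single i 1 : Fin (m + 1) → ℝ) := by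
    ext j
    by_cases hj : j = i
    · subst hj; simp
    · rw [hwj j hj, Pi.smul_apply, Pi.single_eq_of_ne hj, smul_zero]
  have hGw : G' w = 0 := by
    have := congrFun hw i
    rw [hLw i, Pi.single_eq_same, mul_one] at this
    simpa using this
  have hwi : w i = 0 := by
    rw [hweq, map_smul, smul_eq_mul, mul_eq_zero] at hGw
    exact hGw.resolve_right hi
  rw [hweq, hwi, zero_smul]

/-- **Straightening a smooth function along a coordinate.** Let `G` be smooth on an open set
`W ⊆ ℝ^{m+1}` and `∂ᵢ G(k₁) ≠ 0` at `k₁ ∈ W`. Then there is a partial homeomorphism `Φ` of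
`ℝ^{m+1}` — the inverse of `Θ k = k + (G k - kᵢ) eᵢ` near `k₁` (inverse function theorem) — with
`k₁ ∈ Φ.target ⊆ W`, `Φ` smooth on its source with injective differentials, `G (Φ u) = uᵢ` and
`(Φ u)ⱼ = uⱼ` for `j ≠ i`, and a Jacobian determinant of constant sign `σ = ±1` on the source.
[cite: Spivak1965, Thm. 5-1 (proof), Thm. 2-13; Federer1969, 3.1.18] -/
theorem exists_straighten {G : (Fin (m + 1) → ℝ) → ℝ} {W : Set (Fin (m + 1) → ℝ)} (hW : IsOpen W)
    (hG : ContDiffOn ℝ ∞ G W) {k₁ : Fin (m + 1) → ℝ} (hk₁ : k₁ ∈ W) {i : Fin (m + 1)}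
    (hi : fderiv ℝ G k₁ (Pi.single i 1) ≠ 0) :
    ∃ Φ : OpenPartialHomeomorph (Fin (m + 1) → ℝ) (Fin (m + 1) → ℝ),
      Φ.target ⊆ W ∧ k₁ ∈ Φ.target ∧ ContDiffOn ℝ ∞ Φ Φ.source ∧
      (∀ u ∈ Φ.source, G (Φ u) = u i) ∧
      (∀ u ∈ Φ.source, ∀ j, Φ u (i.succAbove j) = u (i.succAbove j)) ∧
      (∀ u ∈ Φ.source, Injective (fderiv ℝ Φ u)) ∧
      ∃ σ : ℝ, (σ = 1 ∨ σ = -1) ∧ ∀ u ∈ Φ.source, |(fderiv ℝ Φ u).det| = σ * (fderiv ℝ Φ u).det := by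
  set v : Fin (m + 1) → ℝ := Pi.single i 1 with hv
  -- the straightening map `Θ` and its derivative
  set Θ : (Fin (m + 1) → ℝ) → (Fin (m + 1) → ℝ) := fun k => k + (G k - k i) • v with hΘ
  set Θ' : (Fin (m + 1) → ℝ) → (Fin (m + 1) → ℝ) →L[ℝ] (Fin (m + 1) → ℝ) := fun k =>
    ContinuousLinearMap.id ℝ (Fin (m + 1) → ℝ) +
      (fderiv ℝ G k - ContinuousLinearMap.proj i).smulRight v with hΘ'
  have hΘi : ∀ k, Θ k i = G k := fun k => by simp [hΘ, hv]
  have hΘj : ∀ k j, Θ k (i.succAbove j) = k (i.succAbove j) := fun k j => by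
    simp [hΘ, hv]
  have hΘsmooth : ContDiffOn ℝ ∞ Θ W :=
    contDiffOn_id.add ((hG.sub (contDiffOn_pi.1 contDiffOn_id i)).smul contDiffOn_const)
  have hΘderiv : ∀ k ∈ W, HasFDerivAt Θ (Θ' k) k := fun k hk => by
    have hGk : HasFDerivAt G (fderiv ℝ G k) k :=
      ((hG.differentiableOn (by simp)) k hk).differentiableAt (hW.mem_nhds hk) |>.hasFDerivAt
    have h1 : HasFDerivAt (fun k : Fin (m + 1) → ℝ => k i) (ContinuousLinearMap.proj i) k :=
      (ContinuousLinearMap.proj (R := ℝ) (φ := fun _ : Fin (m + 1) => ℝ) i).hasFDerivAt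
    exact (hasFDerivAt_id k).add ((hGk.sub h1).smul_const v)
  -- the set where `∂ᵢ G ≠ 0`
  set A : Set (Fin (m + 1) → ℝ) := W ∩ (fderiv ℝ G) ⁻¹' {L | L v ≠ 0} with hA
  have hAo : IsOpen A := by
    refine (hG.continuousOn_fderiv_of_isOpen hW (by simp)).isOpen_inter_preimage hW ?_
    exact isOpen_ne_fun ((ContinuousLinearMap.apply ℝ ℝ v).continuous) continuous_const
  have hk₁A : k₁ ∈ A := ⟨hk₁, hi⟩
  have hAW : A ⊆ W := inter_subset_left
  have hequiv : ∀ k ∈ A, ∃ L : (Fin (m + 1) → ℝ) ≃L[ℝ] (Fin (m + 1) → ℝ),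
      (L : (Fin (m + 1) → ℝ) →L[ℝ] (Fin (m + 1) → ℝ)) = Θ' k := fun k hk => by
    have hinj : Injective (Θ' k) := injective_id_add_smulRight hk.2
    refine ⟨(LinearEquiv.ofInjectiveEndo ((Θ' k : (Fin (m + 1) → ℝ) →L[ℝ] (Fin (m + 1) → ℝ)) :
      (Fin (m + 1) → ℝ) →ₗ[ℝ] (Fin (m + 1) → ℝ)) hinj).toContinuousLinearEquiv, ?_⟩
    ext1 w
    rfl
  -- the inverse function theorem at `k₁`
  obtain ⟨L₁, hL₁⟩ := hequiv k₁ hk₁A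
  have hΘ₁ : ContDiffAt ℝ ∞ Θ k₁ := hΘsmooth.contDiffAt (hW.mem_nhds hk₁)
  have hd₁ : HasFDerivAt Θ (L₁ : (Fin (m + 1) → ℝ) →L[ℝ] (Fin (m + 1) → ℝ)) k₁ := by
    rw [hL₁]; exact hΘderiv k₁ hk₁
  set P := hΘ₁.toOpenPartialHomeomorph Θ hd₁ (by simp) with hP
  have hPΘ : (P : (Fin (m + 1) → ℝ) → (Fin (m + 1) → ℝ)) = Θ := rfl
  have hk₁P : k₁ ∈ P.source := hΘ₁.mem_toOpenPartialHomeomorph_source hd₁ (by simp)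
  -- restrict to `A` and invert
  set P₁ := P.restrOpen A hAo with hP₁
  have hP₁src : P₁.source = P.source ∩ A := P.restrOpen_source A hAo
  have hP₁Θ : (P₁ : (Fin (m + 1) → ℝ) → (Fin (m + 1) → ℝ)) = Θ := rfl
  set Φ₀ := P₁.symm with hΦ₀
  have hΦ₀src : Φ₀.source = P₁.target := rfl
  have hΦ₀tgt : Φ₀.target = P₁.source := rfl
  have hΦ₀tgtA : Φ₀.target ⊆ A := by rw [hΦ₀tgt, hP₁src]; exact inter_subset_right
  have hk₁Φ₀ : k₁ ∈ Φ₀.target := by rw [hΦ₀tgt, hP₁src]; exact ⟨hk₁P, hk₁A⟩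
  -- `Θ ∘ Φ₀ = id` on the source of `Φ₀`
  have hright : ∀ u ∈ Φ₀.source, Θ (Φ₀ u) = u := fun u hu => by
    have := P₁.right_inv (hΦ₀src ▸ hu)
    rwa [hP₁Θ] at this
  have hΦ₀mem : ∀ u ∈ Φ₀.source, Φ₀ u ∈ A := fun u hu => hΦ₀tgtA (Φ₀.map_source hu)
  -- smoothness and derivative of `Φ₀`
  have hΦ₀deriv : ∀ u ∈ Φ₀.source, ∃ L : (Fin (m + 1) → ℝ) ≃L[ℝ] (Fin (m + 1) → ℝ),
      (L : (Fin (m + 1) → ℝ) →L[ℝ] (Fin (m + 1) → ℝ)) = Θ' (Φ₀ u) ∧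
      HasFDerivAt Φ₀ (L.symm : (Fin (m + 1) → ℝ) →L[ℝ] (Fin (m + 1) → ℝ)) u ∧
      ContDiffAt ℝ ∞ Φ₀ u := fun u hu => by
    obtain ⟨L, hL⟩ := hequiv (Φ₀ u) (hΦ₀mem u hu)
    have hd : HasFDerivAt P₁ (L : (Fin (m + 1) → ℝ) →L[ℝ] (Fin (m + 1) → ℝ)) (P₁.symm u) := by
      rw [hP₁Θ, hL]; exact hΘderiv _ (hAW (hΦ₀mem u hu))
    refine ⟨L, hL, P₁.hasFDerivAt_symm (hΦ₀src ▸ hu) hd, ?_⟩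
    exact P₁.contDiffAt_symm (hΦ₀src ▸ hu) hd
      (hΘsmooth.contDiffAt (hW.mem_nhds (hAW (hΦ₀mem u hu))))
  have hΦ₀smooth : ContDiffOn ℝ ∞ Φ₀ Φ₀.source := fun u hu => by
    obtain ⟨-, -, -, h⟩ := hΦ₀deriv u hu
    exact h.contDiffWithinAt
  have hΦ₀det : ∀ u ∈ Φ₀.source, (fderiv ℝ Φ₀ u).det ≠ 0 := fun u hu => by
    obtain ⟨L, -, hd, -⟩ := hΦ₀deriv u hu
    rw [hd.fderiv]
    exact (LinearEquiv.isUnit_det' (L.symm : (Fin (m + 1) → ℝ) ≃ₗ[ℝ] (Fin (m + 1) → ℝ))).ne_zero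
  -- restrict the source of `Φ₀` to where the Jacobian determinant has the sign of `det DΦ₀(u₁)`
  set u₁ : Fin (m + 1) → ℝ := Θ k₁ with hu₁
  have hu₁src : u₁ ∈ Φ₀.source := by
    rw [hΦ₀src]; exact P₁.map_source (by rw [hP₁src]; exact ⟨hk₁P, hk₁A⟩)
  have hΦ₀u₁ : Φ₀ u₁ = k₁ := P₁.left_inv (by rw [hP₁src]; exact ⟨hk₁P, hk₁A⟩)
  set d₁ : ℝ := (fderiv ℝ Φ₀ u₁).det with hd₁def
  have hd₁0 : d₁ ≠ 0 := hΦ₀det u₁ hu₁src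
  set B : Set (Fin (m + 1) → ℝ) := Φ₀.source ∩ (fun u => (fderiv ℝ Φ₀ u).det) ⁻¹' {d | 0 < d₁ * d}
    with hB
  have hBo : IsOpen B := by
    have hc : ContinuousOn (fun u => (fderiv ℝ Φ₀ u).det) Φ₀.source :=
      ContinuousLinearMap.continuous_det.comp_continuousOn
        (hΦ₀smooth.continuousOn_fderiv_of_isOpen Φ₀.open_source (by simp))
    exact hc.isOpen_inter_preimage Φ₀.open_source (isOpen_lt continuous_const (continuous_const.mul continuous_id))
  have hu₁B : u₁ ∈ B := by
    refine ⟨hu₁src, ?_⟩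
    rw [mem_preimage, mem_setOf_eq, ← hd₁def]
    exact mul_self_pos.2 hd₁0
  set Φ := Φ₀.restrOpen B hBo with hΦdef
  have hΦsrc : Φ.source = Φ₀.source ∩ B := Φ₀.restrOpen_source B hBo
  have hΦcoe : (Φ : (Fin (m + 1) → ℝ) → (Fin (m + 1) → ℝ)) = Φ₀ := rfl
  have hΦsrc' : Φ.source ⊆ Φ₀.source := by rw [hΦsrc]; exact inter_subset_left
  refine ⟨Φ, ?_, ?_, ?_, ?_, ?_, ?_, ?_⟩
  · -- `Φ.target ⊆ W`
    intro x hx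
    have h1 : Φ.symm x ∈ Φ.source := Φ.map_target hx
    have h2 : Φ (Φ.symm x) = x := Φ.right_inv hx
    have h3 : Φ₀ (Φ.symm x) ∈ Φ₀.target := Φ₀.map_source (hΦsrc' h1)
    rw [← h2]
    exact hAW (hΦ₀tgtA h3)
  · -- `k₁ ∈ Φ.target`
    rw [← hΦ₀u₁]
    exact Φ.map_source (by rw [hΦsrc]; exact ⟨hu₁src, hu₁B⟩)
  · exact hΦ₀smooth.mono hΦsrc'
  · intro u hu
    have := congrFun (hright u (hΦsrc' hu)) i
    rwa [hΘi] at this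
  · intro u hu j
    have := congrFun (hright u (hΦsrc' hu)) (i.succAbove j)
    rw [hΘj] at this
    rw [hΦcoe]; exact this
  · intro u hu
    obtain ⟨L, -, hd, -⟩ := hΦ₀deriv u (hΦsrc' hu)
    rw [hΦcoe, hd.fderiv]
    exact L.symm.injective
  · refine ⟨if 0 < d₁ then 1 else -1, by split_ifs <;> simp, fun u hu => ?_⟩
    rw [hΦcoe]
    have huB : 0 < d₁ * (fderiv ℝ Φ₀ u).det := by
      have : u ∈ B := by rw [hΦsrc] at hu; exact hu.2
      exact this.2
    split_ifs with h
    · rw [one_mul, abs_of_pos (pos_of_mul_pos_right huB h.le)]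
    · push Not at h
      have hd₁neg : d₁ < 0 := lt_of_le_of_ne h hd₁0
      have : (fderiv ℝ Φ₀ u).det < 0 := by
        by_contra hcon
        push Not at hcon
        have := mul_nonpos_of_nonpos_of_nonneg hd₁neg.le hcon
        linarith
      rw [abs_of_neg this]; ring

end Straighten

/-! ### Local Gauss–Green at a regular level -/

section Local

variable {m : ℕ}

/-- A continuous linear form on `ℝ^{m+1}` vanishing on the coordinate vectors vanishes. [folklore] -/
private theorem exists_apply_single_ne_zero {G' : (Fin (m + 1) → ℝ) →L[ℝ] ℝ} (hG' : G' ≠ 0) :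
    ∃ i : Fin (m + 1), G' (Pi.single i 1) ≠ 0 := by
  by_contra hcon
  push Not at hcon
  refine hG' (ContinuousLinearMap.ext fun w => ?_)
  rw [zero_apply, pi_eq_sum_univ w, map_sum]
  refine Finset.sum_eq_zero fun i _ => ?_
  rw [show (w i • fun j => if i = j then (1 : ℝ) else 0) = w i • (Pi.single i 1 : Fin (m + 1) → ℝ)
    from by ext j; simp [Pi.single_apply, eq_comm], map_smul, hcon i, smul_zero]

/-- **Local Gauss–Green formula at a regular level.** Let `G` be smooth on an open set
`W ⊆ ℝ^{m+1}` with `dG(k₁) ≠ 0` at `k₁ ∈ W`. Then there are a coordinate `i` (one with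
`∂ᵢ G(k₁) ≠ 0`), a straightening partial homeomorphism `Φ` with `k₁ ∈ Φ.target ⊆ W`, smooth on
its source with injective differentials, `G ∘ Φ = uᵢ` and `(Φ u)ⱼ = uⱼ` for `j ≠ i`
(`exists_straighten`), and a sign `θ = ±1`, such that for every compactly supported `C¹` real
`m`-form `α` with support in `Φ.target` and every level `t`,
`∫_{Φ.target ∩ {t < G}} dα(e₀, …, e_m) dx = θ ∫_{y | insᵢ t y ∈ Φ.source} α(Φ(insᵢ t y))(DΦ(insᵢ t y) e ∘ succAbove i) dy`
— the boundary of the superlevel set `{G > t}` near `k₁` is the level set `{G = t}`, parametrised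
over `ℝ^m` by `y ↦ Φ(insᵢ t y)`. [cite: Spivak1965, Thm. 5-5; Federer1969, 3.2.3, 4.1.7] -/
theorem exists_nhds_integral_extDeriv_superlevel_eq {G : (Fin (m + 1) → ℝ) → ℝ}
    {W : Set (Fin (m + 1) → ℝ)} (hW : IsOpen W) (hG : ContDiffOn ℝ ∞ G W) {k₁ : Fin (m + 1) → ℝ}
    (hk₁ : k₁ ∈ W) (hdG : fderiv ℝ G k₁ ≠ 0) :
    ∃ (i : Fin (m + 1)) (Φ : OpenPartialHomeomorph (Fin (m + 1) → ℝ) (Fin (m + 1) → ℝ)) (θ : ℤ),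
      Φ.target ⊆ W ∧ k₁ ∈ Φ.target ∧ ContDiffOn ℝ ∞ Φ Φ.source ∧
      (∀ u ∈ Φ.source, G (Φ u) = u i) ∧
      (∀ u ∈ Φ.source, ∀ j, Φ u (i.succAbove j) = u (i.succAbove j)) ∧
      (∀ u ∈ Φ.source, Injective (fderiv ℝ Φ u)) ∧ (θ = 1 ∨ θ = -1) ∧
      ∀ (α : (Fin (m + 1) → ℝ) → (Fin (m + 1) → ℝ) [⋀^Fin m]→L[ℝ] ℝ), ContDiff ℝ 1 α →
        HasCompactSupport α → tsupport α ⊆ Φ.target → ∀ t : ℝ,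
          ∫ x in Φ.target ∩ {x | t < G x}, extDeriv α x (fun k => Pi.single k 1) =
            (θ : ℝ) * ∫ y in {y | i.insertNth t y ∈ Φ.source},
              α (Φ (i.insertNth t y)) (fun j => fderiv ℝ Φ (i.insertNth t y) (Pi.single (i.succAbove j) 1)) := by
  obtain ⟨i, hi⟩ := exists_apply_single_ne_zero hdG
  obtain ⟨Φ, hΦW, hk₁Φ, hΦs, hGΦ, hΦj, hΦinj, σ, hσ, hdet⟩ := exists_straighten hW hG hk₁ hi
  -- the sign `θ = -(-1)ⁱ σ`
  obtain ⟨s, hs, hsσ⟩ : ∃ s : ℤ, (s = 1 ∨ s = -1) ∧ (s : ℝ) = σ := by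
    rcases hσ with h | h
    · exact ⟨1, Or.inl rfl, by rw [h]; norm_num⟩
    · exact ⟨-1, Or.inr rfl, by rw [h]; norm_num⟩
  refine ⟨i, Φ, -((-1) ^ (i : ℕ) * s), hΦW, hk₁Φ, hΦs, hGΦ, hΦj, hΦinj, ?_, ?_⟩
  · rcases hs with h | h <;> rcases neg_one_pow_eq_or ℤ (i : ℕ) with h' | h' <;> simp [h, h']
  intro α hα hαs hαΦ t
  -- `Φ.target ∩ {t < G} = Φ(Φ.source ∩ {t < uᵢ})`
  have hset : Φ.target ∩ {x | t < G x} = Φ '' (Φ.source ∩ {u | t < u i}) := by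
    rw [Φ.image_source_inter_eq']
    ext x
    constructor
    · rintro ⟨hx, hGx⟩
      refine ⟨hx, ?_⟩
      show t < Φ.symm x i
      rw [← hGΦ _ (Φ.map_target hx), Φ.right_inv hx]; exact hGx
    · rintro ⟨hx, hx'⟩
      refine ⟨hx, ?_⟩
      show t < G x
      have : t < Φ.symm x i := hx'
      rw [← hGΦ _ (Φ.map_target hx), Φ.right_inv hx] at this; exact this
  rw [hset, integral_extDeriv_image_superlevel_eq Φ (hΦs.of_le (WithTop.coe_le_coe.2 le_top)) hdet
    hα hαs hαΦ i t, ← hsσ]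
  push_cast
  ring

end Local

end Literature.Geometry.GeometricMeasureTheory
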